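import Mathlib.AlgebraicGeometry.EllipticCurve.DivisionPolynomial.Degree
import Literature.NumberTheory.EllipticCurves.DivisionField
import Literature.NumberTheory.EllipticCurves.DivisionPolynomialTorsion
import HarnessLib

/-!
# The `3`-division polynomial by radicals: the `x`-coordinates of `E[3]` from `ζ₃`, `∛Δ` and
# three square roots, and the field `K(x(E[3])) = K(R₀, R₁, R₂) ∋ ζ₃, ∛Δ`

`Proofs` file (theorems only, no definitions, no named facts) in topic
`NumberTheory/EllipticCurves`, landed by the seat of
`WeierstrassCurve.conductorNatOf_geomPoints_eq_conductorNorm_of_isElliptic` (Ogg–Saito at `2` over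
`ℚ`; the remaining leaf is Saito's half of Ogg's formula for the additive curves at `2` with
`ord₂(j) > 0`, `OggFormulaJZeroTwoProofs`, read on `E[3]`: `Sw_𝔓(E[3]) = 2 φ_{K(x(E[3]))/K}(b)`,
`ThreeTorsionCentralInvolutionSwanProofs`).  To compute in the field of `x`-coordinates one needs
it explicitly; this file solves the quartic `Ψ₃` by radicals, uniformly in the coefficients.

**The formula.**  Let `E : y² + a₁xy + a₃y = x³ + a₂x² + a₄x + a₆` with the usual
`b₂, b₄, b₆, b₈, c₄, c₆, Δ` and `Ψ₃ = 3x⁴ + b₂x³ + 3b₄x² + 3b₆x + b₈` (Silverman *AEC* Ex. 3.7;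
Mathlib `WeierstrassCurve.Ψ₃`).  Let `ζ² + ζ + 1 = 0`, `δ³ = Δ`, and
`R₀² = c₄ - 12δ`, `R₁² = c₄ - 12ζδ`, `R₂² = c₄ - 12ζ²δ`, `R₀R₁R₂ = c₆`
(consistent: `∏ᵢ (c₄ - 12ζ^iδ) = c₄³ - 1728Δ = c₆²`).  Then

  `Ψ₃ = 3 ∏_ε (X - x_ε)`,  `x_ε = (-b₂ + ε₀R₀ + ε₁R₁ + ε₂R₂)/12`,  `εᵢ = ±1`, `ε₀ε₁ε₂ = 1`.

Equivalently: for the four roots `x₁, …, x₄` of `Ψ₃`, `(3(x₁ + x₂ - x₃ - x₄))² = c₄ - 12ζ^iδ`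
— the resolvent cubic of the quartic `Ψ₃/3` in the variable `T = (x₁ + x₂ - x₃ - x₄)²` is
`(T - c₄/9)³ = -64Δ/27`, with splitting field `K(ζ₃, ∛Δ)` (the fixed field of the four-group of
`PGL₂(𝔽₃) ≅ S₄` acting on the four cyclic subgroups of `E[3]`; Serre, *Abelian ℓ-adic
representations*, IV.1.1–1.2 and the classical `K(E[3]) ⊇ K(ζ₃, ∛Δ)`).  The identity behind
`twelve_pow_four_mul_eval_Ψ₃_eq_zero_of_radical` was obtained by reducing `12⁴Ψ₃(x_ε)` modulo
the relations (a small computer-algebra computation) and is certified by `linear_combination`.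

**Contents.**

* §1 (commutative ring): `eval_Ψ₃_eq`;
  `twelve_pow_four_mul_eval_Ψ₃_eq_zero_of_radical` (**`12⁴ Ψ₃(x_ε) = 0`**);
  `prod_c₄_sub_twelve_mul_eq_c₆_sq` (`∏ (c₄ - 12ζ^iδ) = c₆²`);
  `Δ_sq_eq_zero_of_eval_Ψ₂Sq_eq_zero_of_eval_Ψ₃_eq_zero` (**`Res(Ψ₂², Ψ₃) = -Δ²`** in cofactor
  form: a common root of `Ψ₂² = 4x³ + b₂x² + 2b₄x + b₆` and `Ψ₃` forces `Δ² = 0`).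
* §2 (field, `2, 3 ≠ 0`): `eval_Ψ₃_eq_zero_of_radical` (the four roots), `radical_sq_ne`,
  `radical_roots_nodup` (they are distinct when `δ ≠ 0`), **`roots_Ψ₃_eq_of_radical`**
  (`Ψ₃.roots = {x₁, x₂, x₃, x₄}`), **`eval_Ψ₃_eq_zero_iff_radical`**,
  `eval_Ψ₂Sq_ne_zero_of_eval_Ψ₃_eq_zero`.
* §3: `exists_radical` — radical data exist over an algebraically closed field.
* §4 (`E/K` elliptic, `2, 3 ≠ 0` in `K`, data in `K̄`): `exists_geomTorsion_three_eq_some_of_radical`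
  (**each `x_ε` is `x(T)` for some `T ∈ E[3] ∖ O`**, via *AEC* Ex. 3.7:
  `three_smul_some_eq_zero_iff` of `DivisionPolynomialTorsion`, the point not being of order `2`
  by §1) and `radical_of_geomTorsion_three_eq_some` (**every `x(T)`, `T ∈ E[3] ∖ O`, is an `x_ε`**).
* §5: **`σ ∈ Γ_K` fixes `x(E[3])` iff it fixes `R₀, R₁, R₂`** (`mem_xFixingSubgroup_three_iff_radical`,
  for the subgroup `xFixingSubgroup W 3` of `DivisionField`), `radical_mem_xDivisionField_three`,
  `zeta_mem_and_delta_mem_xDivisionField_three` (**`ζ₃, ∛Δ ∈ K(x(E[3]))`**), and for `char K = 0`: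
  `absRestrictNormalHom_xDivisionField_three_eq_one_iff_radical` (**`σ|_{K(x(E[3]))} = 1 ↔ σRᵢ = Rᵢ`**)
  and **`xDivisionField_three_eq_adjoin_radical`: `K(x(E[3])) = K(R₀, R₁, R₂)`**.

So `K(x(E[3])) = K(ζ₃, ∛Δ, R₀, R₁, R₂)`, of degree dividing `24` over `K`, biquadratic over
`K(ζ₃, ∛Δ)`; above `2`, where `K(ζ₃, ∛Δ)` is unramified as soon as `3 ∣ v(Δ)`, its ramification
is read off the square classes of the three elements `c₄ - 12ζ^i∛Δ`.

**Relation to `ThreeTorsionRadicalsProofs` / `ThreeTorsionRadicalsPointsProofs`.**  The same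
radical solution was landed independently and simultaneously by the seat of bsd.S15 in those two
files (variables `ω, δ, U₀, U₁, U₂` there ↔ `ζ, δ, R₀, R₁, R₂` here, with *identical* relations
`U_k² = c₄ - 12ωᵏδ`, `U₀U₁U₂ = c₆`, and `z = 12x + b₂`), together with the Kummer generator of the
quadratic layer; §§1–3 below overlap with them (different proofs: a direct certificate for
`12⁴Ψ₃(x_ε)`, the roots through `Polynomial.roots`, the resultant in `bᵢ`-form), and are kept
because §§4–5 — the statements about the tree's `geomTorsion W 3`, `xFixingSubgroup W 3` and
`xDivisionField W 3`, which are the point of this file — are built on them.  Hypotheses of the two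
files are interchangeable verbatim.

## References

* J. H. Silverman, *The Arithmetic of Elliptic Curves*, 2nd ed., GTM 106 (2009), III.§1
  (`b₂, …, c₆, Δ`, `1728Δ = c₄³ - c₆²`), III.2.3 (group law), Exercise 3.7 (division polynomials;
  `ψ₃ = 3x⁴ + b₂x³ + 3b₄x² + 3b₆x + b₈`; `ψₙ(P) = 0` iff `P ∈ E[n] ∖ O`). [SilvermanAEC2009]
* J.-P. Serre, *Abelian ℓ-adic representations and elliptic curves* (1968), IV.1.1–1.2
  (`K(E[ℓ])`, the image of `Γ_K` in `GL₂(𝔽_ℓ) `; `PGL₂(𝔽₃) ≅ S₄`). [SerreAbelianLadic1968]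
* J. H. Silverman, *Advanced Topics in the Arithmetic of Elliptic Curves*, GTM 151 (1994), §IV.10
  (the conductor through `L = K(E[ℓ])`), Thm. IV.11.1 (`p = 2`, PDF p. 366). [SilvermanATAEC1994]

## Design

Theorems only; `noncomputable section`; namespace `WeierstrassCurve`.  The radical data are
carried as explicit hypotheses `hζ, hδ, h₀, h₁, h₂, hρ` (no structure is introduced); over `K̄`
they are stated with `algebraMap K K̄` of the invariants of `W`.  The geometric `3`-torsion is the
tree's `geomTorsion W (3 : ℕ)` (`GaloisAction`), the fields are `DivisionField`'s
`xFixingSubgroup`/`xDivisionField`.  Axioms: `propext`, `Classical.choice`, `Quot.sound`.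
-/

noncomputable section

open Polynomial
open scoped Classical

universe u

namespace WeierstrassCurve

/-! ### §1. The radical formula over a commutative ring -/

section Ring

variable {R : Type*} [CommRing R] (W : WeierstrassCurve R)

/-- `Ψ₃(x) = 3x⁴ + b₂x³ + 3b₄x² + 3b₆x + b₈`. [folklore] -/
theorem eval_Ψ₃_eq (x : R) :
    W.Ψ₃.eval x = 3 * x ^ 4 + W.b₂ * x ^ 3 + 3 * W.b₄ * x ^ 2 + 3 * W.b₆ * x + W.b₈ := by
  simp only [Ψ₃, eval_add, eval_mul, eval_pow, eval_C, eval_X, eval_ofNat]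

/-- **The radical formula for the `3`-division polynomial (ring form).**  Let `ζ² + ζ + 1 = 0`,
`R₀² = c₄ - 12δ`, `R₁² = c₄ - 12ζδ`, `R₂² = c₄ - 12ζ²δ` and `R₀R₁R₂ = c₆`.  Then
`12⁴ · Ψ₃(x) = 0` for `12x = -b₂ + R₀ + R₁ + R₂`: an explicit identity in
`ℤ[a₁, …, a₆, ζ, δ, R₀, R₁, R₂]` (found by reducing `12⁴Ψ₃` modulo the five relations; checked by
`linear_combination`).  This is the classical solution of the quartic `Ψ₃` by radicals: its
resolvent cubic is `(T - c₄/9)³ = -64Δ/27`, i.e. `(x₁ + x₂ - x₃ - x₄)² = (c₄ - 12 ζ^i ∛Δ)/9`.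
[cite: SilvermanAEC2009, Exercise 3.7 (ψ₃ = 3x⁴ + b₂x³ + 3b₄x² + 3b₆x + b₈)] -/
theorem twelve_pow_four_mul_eval_Ψ₃_eq_zero_of_radical {ζ δ R₀ R₁ R₂ x : R}
    (hζ : ζ ^ 2 + ζ + 1 = 0)
    (h₀ : R₀ ^ 2 = W.c₄ - 12 * δ) (h₁ : R₁ ^ 2 = W.c₄ - 12 * ζ * δ)
    (h₂ : R₂ ^ 2 = W.c₄ - 12 * ζ ^ 2 * δ) (hρ : R₀ * R₁ * R₂ = W.c₆)
    (hx : 12 * x = -W.b₂ + R₀ + R₁ + R₂) :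
    12 ^ 4 * W.Ψ₃.eval x = 0 := by
  rw [eval_Ψ₃_eq]
  simp only [WeierstrassCurve.c₄, WeierstrassCurve.c₆, WeierstrassCurve.b₂, WeierstrassCurve.b₄,
    WeierstrassCurve.b₆, WeierstrassCurve.b₈] at h₀ h₁ h₂ hρ hx ⊢
  linear_combination (-288 * W.a₁ ^ 4 * δ - 2304 * W.a₁ ^ 2 * W.a₂ * δ + 432 * δ ^ 2 * ζ ^ 2 - 144 * R₀ * R₁ * δ - 144 * R₀ * R₂ * δ - 144 * R₁ * R₂ * δ + 6912 * W.a₁ * W.a₃ * δ - 4608 * W.a₂ ^ 2 * δ + 2160 * δ ^ 2 * ζ + 13824 * W.a₄ * δ + 432 * δ ^ 2) * hζ + (-15 * W.a₁ ^ 4 - 120 * W.a₁ ^ 2 * W.a₂ + 12 * R₀ * R₁ + 12 * R₀ * R₂ + 3 * R₀ ^ 2 + 12 * R₁ * R₂ + 18 * R₁ ^ 2 + 18 * R₂ ^ 2 + 360 * W.a₁ * W.a₃ - 240 * W.a₂ ^ 2 + 720 * W.a₄ - 36 * δ) * h₀ + (3 * W.a₁ ^ 4 + 24 * W.a₁ ^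 2 * W.a₂ + 12 * R₀ * R₁ + 12 * R₀ * R₂ + 12 * R₁ * R₂ + 3 * R₁ ^ 2 + 18 * R₂ ^ 2 - 72 * W.a₁ * W.a₃ + 48 * W.a₂ ^ 2 - 36 * δ * ζ - 144 * W.a₄ - 216 * δ) * h₁ + (21 * W.a₁ ^ 4 + 168 * W.a₁ ^ 2 * W.a₂ - 36 * δ * ζ ^ 2 + 12 * R₀ * R₁ + 12 * R₀ * R₂ + 12 * R₁ * R₂ + 3 * R₂ ^ 2 - 504 * W.a₁ * W.a₃ + 336 * W.a₂ ^ 2 - 216 * δ * ζ - 1008 * W.a₄ - 216 * δ) * h₂ + (24 * R₀ + 24 * R₁ + 24 * R₂) * hρ + (9 * W.a₁ ^ 6 - 15 * R₀ * W.a₁ ^ 4 - 15 * R₁ * W.a₁ ^ 4 - 15 * R₂ * W.a₁ ^ 4 + 108 * W.a₁ ^ 4 * W.a₂ - 108 * W.a₁ ^ 4 * x + 6 * R₀ * R₁ * W.a₁ ^ 2 + 6 * R₀ * R₂ * W.a₁ ^ 2 - 120 * R₀ * W.a₁ ^ 2 * W.a₂ + 72 * R₀ * W.a₁ ^ 2 *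 x + 3 * R₀ ^ 2 * W.a₁ ^ 2 + 6 * R₁ * R₂ * W.a₁ ^ 2 - 120 * R₁ * W.a₁ ^ 2 * W.a₂ + 72 * R₁ * W.a₁ ^ 2 * x + 3 * R₁ ^ 2 * W.a₁ ^ 2 - 120 * R₂ * W.a₁ ^ 2 * W.a₂ + 72 * R₂ * W.a₁ ^ 2 * x + 3 * R₂ ^ 2 * W.a₁ ^ 2 - 864 * W.a₁ ^ 2 * W.a₂ * x + 432 * W.a₁ ^ 2 * W.a₂ ^ 2 + 1296 * W.a₁ ^ 2 * x ^ 2 - 432 * W.a₁ ^ 3 * W.a₃ + 18 * R₀ * R₁ * R₂ + 24 * R₀ * R₁ * W.a₂ + 72 * R₀ * R₁ * x + 9 * R₀ * R₁ ^ 2 + 24 * R₀ * R₂ * W.a₂ + 72 * R₀ * R₂ * x + 9 * R₀ * R₂ ^ 2 + 432 * R₀ * W.a₁ * W.a₃ + 288 * R₀ * W.a₂ * x - 240 * R₀ * W.a₂ ^ 2 + 432 * R₀ * x ^ 2 + 9 * R₀ ^ 2 * R₁ + 9 * R₀ ^ 2 * R₂ + 12 * R₀ ^ 2 * W.a₂ +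 36 * R₀ ^ 2 * x + 3 * R₀ ^ 3 + 24 * R₁ * R₂ * W.a₂ + 72 * R₁ * R₂ * x + 9 * R₁ * R₂ ^ 2 + 432 * R₁ * W.a₁ * W.a₃ + 288 * R₁ * W.a₂ * x - 240 * R₁ * W.a₂ ^ 2 + 432 * R₁ * x ^ 2 + 9 * R₁ ^ 2 * R₂ + 12 * R₁ ^ 2 * W.a₂ + 36 * R₁ ^ 2 * x + 3 * R₁ ^ 3 + 432 * R₂ * W.a₁ * W.a₃ + 288 * R₂ * W.a₂ * x - 240 * R₂ * W.a₂ ^ 2 + 432 * R₂ * x ^ 2 + 12 * R₂ ^ 2 * W.a₂ + 36 * R₂ ^ 2 * x + 3 * R₂ ^ 3 - 1728 * W.a₁ * W.a₂ * W.a₃ + 5184 * W.a₁ * W.a₃ * x - 864 * W.a₁ ^ 2 * W.a₄ + 5184 * W.a₂ * x ^ 2 - 1728 * W.a₂ ^ 2 * x + 576 * W.a₂ ^ 3 + 5184 * x ^ 3 + 864 * R₀ * W.a₄ + 864 * R₁ * W.a₄ + 864 * R₂ * W.a₄ - 3456 * W.a₂ * W.a₄ + 5184 * W.a₃ ^ 2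 + 10368 * W.a₄ * x + 20736 * W.a₆) * hx

/-- **`(c₄ - 12δ)(c₄ - 12ζδ)(c₄ - 12ζ²δ) = c₆²`** for `ζ² + ζ + 1 = 0` and `δ³ = Δ`
(`c₄³ - c₆² = 1728Δ`, Mathlib `c_relation`, and `ζ³ = 1`). [folklore] -/
theorem prod_c₄_sub_twelve_mul_eq_c₆_sq {ζ δ : R} (hζ : ζ ^ 2 + ζ + 1 = 0) (hδ : δ ^ 3 = W.Δ) :
    (W.c₄ - 12 * δ) * (W.c₄ - 12 * ζ * δ) * (W.c₄ - 12 * ζ ^ 2 * δ) = W.c₆ ^ 2 := by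
  have hc := W.c_relation
  linear_combination (-(12 * W.c₄ ^ 2 * δ) + 144 * W.c₄ * δ ^ 2 * ζ - 1728 * δ ^ 3 * ζ +
    1728 * δ ^ 3) * hζ + (-1728) * hδ + (-1) * hc

/-- **`Ψ₂²` and `Ψ₃` have no common root when `Δ ≠ 0`**: `Δ² = λ·(4b₈ - b₂b₆ + b₄²) - U·Ψ₂²(x) -
V·Ψ₃(x)` for explicit `U, V, λ` (the resultant of `Ψ₂²` and `Ψ₃` is `-Δ²`; cofactors from the
Sylvester matrix), so a common root gives `Δ² = 0`. [cite: SilvermanAEC2009, Exercise 3.7] -/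
theorem Δ_sq_eq_zero_of_eval_Ψ₂Sq_eq_zero_of_eval_Ψ₃_eq_zero {x : R} (hF : W.Ψ₂Sq.eval x = 0)
    (hG : W.Ψ₃.eval x = 0) : W.Δ ^ 2 = 0 := by
  simp only [Ψ₂Sq, eval_add, eval_mul, eval_pow, eval_C, eval_X] at hF
  rw [eval_Ψ₃_eq] at hG
  have hb := W.b_relation
  rw [WeierstrassCurve.Δ]
  linear_combination (-(6 * W.b₂ ^ 2 * W.b₄ ^ 2 * x ^ 3 + 2 * W.b₂ ^ 3 * W.b₄ ^ 2 * x ^ 2 - 6 * W.b₂ ^ 3 * W.b₆ * x ^ 3 - 2 * W.b₂ ^ 4 * W.b₆ * x ^ 2 - 12 * W.b₈ * W.b₂ ^ 2 * x ^ 3 - W.b₈ * W.b₂ ^ 3 * x ^ 2 + W.b₈ * W.b₂ ^ 4 * x + 252 * W.b₂ * W.b₄ * W.b₆ * x ^ 3 - 72 * W.b₂ * W.b₄ ^ 3 * x ^ 2 + 81 * W.b₂ ^ 2 * W.b₄ * W.b₆ * x ^ 2 + 6 * W.b₂ ^ 2 * W.b₄ ^ 3 * x - 7 * W.b₂ ^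 3 * W.b₄ * W.b₆ * x - 216 * W.b₄ ^ 3 * x ^ 3 - 50 * W.b₈ * W.b₂ ^ 2 * W.b₄ * x + W.b₈ * W.b₂ ^ 3 * W.b₄ + 288 * W.b₈ * W.b₄ * x ^ 3 + 288 * W.b₂ * W.b₄ ^ 2 * W.b₆ * x - 351 * W.b₂ * W.b₆ ^ 2 * x ^ 2 + 3 * W.b₂ ^ 2 * W.b₄ ^ 2 * W.b₆ - 3 * W.b₂ ^ 2 * W.b₆ ^ 2 * x - 4 * W.b₂ ^ 3 * W.b₆ ^ 2 + 108 * W.b₄ ^ 2 * W.b₆ * x ^ 2 - 216 * W.b₄ ^ 4 * x - 972 * W.b₆ ^ 2 * x ^ 3 - 36 * W.b₈ * W.b₂ * W.b₄ ^ 2 + 168 * W.b₈ * W.b₂ * W.b₆ * x - 7 * W.b₈ * W.b₂ ^ 2 * W.b₆ + 432 * W.b₈ * W.b₄ ^ 2 * x + 432 * W.b₈ * W.b₆ * x ^ 2 + 162 * W.b₂ * W.b₄ * W.b₆ ^ 2 - 1134 * W.b₄ * W.b₆ ^ 2 * x - 108 * W.b₄ ^ 3 * W.b₆ + 432 * W.b₈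 * W.b₄ * W.b₆ - 16 * W.b₈ ^ 2 * W.b₂ - 192 * W.b₈ ^ 2 * x - 729 * W.b₆ ^ 3)) * hF + (-(-8 * W.b₂ ^ 2 * W.b₄ ^ 2 * x ^ 2 - 2 * W.b₂ ^ 3 * W.b₄ ^ 2 * x + 8 * W.b₂ ^ 3 * W.b₆ * x ^ 2 + 2 * W.b₂ ^ 4 * W.b₆ * x + 16 * W.b₈ * W.b₂ ^ 2 * x ^ 2 - W.b₈ * W.b₂ ^ 4 - 336 * W.b₂ * W.b₄ * W.b₆ * x ^ 2 + 72 * W.b₂ * W.b₄ ^ 3 * x - 80 * W.b₂ ^ 2 * W.b₄ * W.b₆ * x - 4 * W.b₂ ^ 2 * W.b₄ ^ 3 + 5 * W.b₂ ^ 3 * W.b₄ * W.b₆ + 288 * W.b₄ ^ 3 * x ^ 2 + 32 * W.b₈ * W.b₂ * W.b₄ * x + 48 * W.b₈ * W.b₂ ^ 2 * W.b₄ - 384 * W.b₈ * W.b₄ * x ^ 2 - 204 * W.b₂ * W.b₄ ^ 2 * W.b₆ + 360 * W.b₂ * W.b₆ ^ 2 * x + W.b₂ ^ 2 * W.b₆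 ^ 2 - 144 * W.b₄ ^ 2 * W.b₆ * x + 144 * W.b₄ ^ 4 + 1296 * W.b₆ ^ 2 * x ^ 2 - 176 * W.b₈ * W.b₂ * W.b₆ - 384 * W.b₈ * W.b₄ ^ 2 - 576 * W.b₈ * W.b₆ * x + 864 * W.b₄ * W.b₆ ^ 2 + 256 * W.b₈ ^ 2)) * hG + (12 * W.b₈ * W.b₂ ^ 2 * W.b₄ - 80 * W.b₂ * W.b₄ ^ 2 * W.b₆ + 4 * W.b₂ ^ 2 * W.b₆ ^ 2 + 64 * W.b₄ ^ 4 - 32 * W.b₈ * W.b₂ * W.b₆ - 112 * W.b₈ * W.b₄ ^ 2 + 324 * W.b₄ * W.b₆ ^ 2 + 64 * W.b₈ ^ 2) * hb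

end Ring

/-! ### §2. Over a field: the four roots `x_ε = (-b₂ + ε₀R₀ + ε₁R₁ + ε₂R₂)/12`, `ε₀ε₁ε₂ = 1` -/

section Field

variable {F : Type*} [Field F] (W : WeierstrassCurve F)

/-- **`Ψ₃(x_ε) = 0`**: for signs `εᵢ = ±1` with `ε₀ε₁ε₂ = 1`, the element `x` with
`12x = -b₂ + ε₀R₀ + ε₁R₁ + ε₂R₂` is a root of `Ψ₃` (`12 ≠ 0` in `F`); apply the ring identity to
`(ε₀R₀, ε₁R₁, ε₂R₂)`. [cite: SilvermanAEC2009, Exercise 3.7] -/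
theorem eval_Ψ₃_eq_zero_of_radical (h12 : (12 : F) ≠ 0) {ζ δ R₀ R₁ R₂ x : F}
    (hζ : ζ ^ 2 + ζ + 1 = 0)
    (h₀ : R₀ ^ 2 = W.c₄ - 12 * δ) (h₁ : R₁ ^ 2 = W.c₄ - 12 * ζ * δ)
    (h₂ : R₂ ^ 2 = W.c₄ - 12 * ζ ^ 2 * δ) (hρ : R₀ * R₁ * R₂ = W.c₆)
    {ε₀ ε₁ ε₂ : F} (hε₀ : ε₀ ^ 2 = 1) (hε₁ : ε₁ ^ 2 = 1) (hε₂ : ε₂ ^ 2 = 1)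
    (hε : ε₀ * ε₁ * ε₂ = 1) (hx : 12 * x = -W.b₂ + ε₀ * R₀ + ε₁ * R₁ + ε₂ * R₂) :
    W.Ψ₃.eval x = 0 := by
  have h₀' : (ε₀ * R₀) ^ 2 = W.c₄ - 12 * δ := by linear_combination R₀ ^ 2 * hε₀ + h₀
  have h₁' : (ε₁ * R₁) ^ 2 = W.c₄ - 12 * ζ * δ := by linear_combination R₁ ^ 2 * hε₁ + h₁
  have h₂' : (ε₂ * R₂) ^ 2 = W.c₄ - 12 * ζ ^ 2 * δ := by linear_combination R₂ ^ 2 * hε₂ + h₂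
  have hρ' : ε₀ * R₀ * (ε₁ * R₁) * (ε₂ * R₂) = W.c₆ := by
    linear_combination R₀ * R₁ * R₂ * hε + hρ
  have key := W.twelve_pow_four_mul_eval_Ψ₃_eq_zero_of_radical hζ h₀' h₁' h₂' hρ' hx
  have h124 : (12 : F) ^ 4 ≠ 0 := pow_ne_zero 4 h12
  exact (mul_eq_zero.mp key).resolve_left h124

/-- `ζ ≠ 1`, `ζ ≠ 0`, `ζ² ≠ 1` for a root of `ζ² + ζ + 1` when `3 ≠ 0`. [folklore] -/
theorem ne_of_sq_add_self_add_one (h3 : (3 : F) ≠ 0) {ζ : F} (hζ : ζ ^ 2 + ζ + 1 = 0) :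
    ζ ≠ 1 ∧ ζ ≠ 0 ∧ ζ ^ 2 ≠ 1 := by
  refine ⟨?_, ?_, ?_⟩
  · rintro rfl; apply h3; linear_combination hζ
  · rintro rfl; simp at hζ
  · intro h
    have hz : ζ = -2 := by linear_combination hζ - h
    subst hz
    apply h3; linear_combination h

/-- The squares `R₀², R₁², R₂²` are pairwise distinct when `2, 3 ≠ 0` and `δ ≠ 0`. [folklore] -/
theorem radical_sq_ne (h2 : (2 : F) ≠ 0) (h3 : (3 : F) ≠ 0) {ζ δ R₀ R₁ R₂ : F}
    (hζ : ζ ^ 2 + ζ + 1 = 0) (hδ : δ ≠ 0)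
    (h₀ : R₀ ^ 2 = W.c₄ - 12 * δ) (h₁ : R₁ ^ 2 = W.c₄ - 12 * ζ * δ)
    (h₂ : R₂ ^ 2 = W.c₄ - 12 * ζ ^ 2 * δ) :
    R₀ ^ 2 ≠ R₁ ^ 2 ∧ R₀ ^ 2 ≠ R₂ ^ 2 ∧ R₁ ^ 2 ≠ R₂ ^ 2 := by
  obtain ⟨hz1, hz0, hz2⟩ := ne_of_sq_add_self_add_one h3 hζ
  have h12 : (12 : F) ≠ 0 := by
    rw [show (12 : F) = 2 * 2 * 3 by norm_num]; exact mul_ne_zero (mul_ne_zero h2 h2) h3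
  refine ⟨?_, ?_, ?_⟩
  · intro h
    have : 12 * δ * (ζ - 1) = 0 := by linear_combination h₁ - h₀ + h
    rcases mul_eq_zero.mp this with h' | h'
    · exact (mul_ne_zero h12 hδ) h'
    · exact hz1 (sub_eq_zero.mp h')
  · intro h
    have : 12 * δ * (ζ ^ 2 - 1) = 0 := by linear_combination h₂ - h₀ + h
    rcases mul_eq_zero.mp this with h' | h'
    · exact (mul_ne_zero h12 hδ) h'
    · exact hz2 (sub_eq_zero.mp h')
  · intro h
    have : 12 * δ * ζ * (ζ - 1) = 0 := by linear_combination h₂ - h₁ + h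
    rcases mul_eq_zero.mp this with h' | h'
    · rcases mul_eq_zero.mp h' with h'' | h''
      · exact (mul_ne_zero h12 hδ) h''
      · exact hz0 h''
    · exact hz1 (sub_eq_zero.mp h')

/-- `a² ≠ b²` gives `a + b ≠ 0` and `a - b ≠ 0`. [folklore] -/
theorem add_ne_zero_and_sub_ne_zero_of_sq_ne {a b : F} (h : a ^ 2 ≠ b ^ 2) :
    a + b ≠ 0 ∧ a - b ≠ 0 := by
  constructor
  · intro h'; apply h
    have : a = -b := by linear_combination h'
    rw [this, neg_sq]
  · intro h'; apply h
    rw [sub_eq_zero.mp h']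

/-- **The four roots are distinct.**  With `12xᵢ = -b₂ ± R₀ ± R₁ ± R₂` (even number of minus
signs), the `xᵢ` are pairwise distinct as soon as `2, 3 ≠ 0` and `δ ≠ 0` (their differences are
`(Rᵢ ± Rⱼ)/6`, and `Rᵢ² ≠ Rⱼ²`). [cite: SilvermanAEC2009, Exercise 3.7] -/
theorem radical_roots_nodup (h2 : (2 : F) ≠ 0) (h3 : (3 : F) ≠ 0) {ζ δ R₀ R₁ R₂ : F}
    (hζ : ζ ^ 2 + ζ + 1 = 0) (hδ : δ ≠ 0)
    (h₀ : R₀ ^ 2 = W.c₄ - 12 * δ) (h₁ : R₁ ^ 2 = W.c₄ - 12 * ζ * δ)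
    (h₂ : R₂ ^ 2 = W.c₄ - 12 * ζ ^ 2 * δ) {x₁ x₂ x₃ x₄ : F}
    (hx₁ : 12 * x₁ = -W.b₂ + R₀ + R₁ + R₂) (hx₂ : 12 * x₂ = -W.b₂ + R₀ - R₁ - R₂)
    (hx₃ : 12 * x₃ = -W.b₂ - R₀ + R₁ - R₂) (hx₄ : 12 * x₄ = -W.b₂ - R₀ - R₁ + R₂) :
    ({x₁, x₂, x₃, x₄} : Multiset F).Nodup := by
  obtain ⟨h01, h02, h12'⟩ := W.radical_sq_ne h2 h3 hζ hδ h₀ h₁ h₂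
  obtain ⟨hp01, hm01⟩ := add_ne_zero_and_sub_ne_zero_of_sq_ne h01
  obtain ⟨hp02, hm02⟩ := add_ne_zero_and_sub_ne_zero_of_sq_ne h02
  obtain ⟨hp12, hm12⟩ := add_ne_zero_and_sub_ne_zero_of_sq_ne h12'
  have cancel : ∀ {t : F}, 2 * t = 0 → t = 0 := fun ht ↦ (mul_eq_zero.mp ht).resolve_left h2
  have ne12 : x₁ ≠ x₂ := fun h ↦ hp12 (cancel (by linear_combination (-1) * hx₁ + hx₂ + 12 * h))
  have ne13 : x₁ ≠ x₃ := fun h ↦ hp02 (cancel (by linear_combination (-1) * hx₁ + hx₃ + 12 * h))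
  have ne14 : x₁ ≠ x₄ := fun h ↦ hp01 (cancel (by linear_combination (-1) * hx₁ + hx₄ + 12 * h))
  have ne23 : x₂ ≠ x₃ := fun h ↦ hm01 (cancel (by linear_combination (-1) * hx₂ + hx₃ + 12 * h))
  have ne24 : x₂ ≠ x₄ := fun h ↦ hm02 (cancel (by linear_combination (-1) * hx₂ + hx₄ + 12 * h))
  have ne34 : x₃ ≠ x₄ := fun h ↦ hm12 (cancel (by linear_combination (-1) * hx₃ + hx₄ + 12 * h))
  simp only [Multiset.insert_eq_cons, Multiset.nodup_cons, Multiset.mem_cons,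
    Multiset.mem_singleton, Multiset.nodup_singleton, and_true, not_or]
  exact ⟨⟨ne12, ne13, ne14⟩, ⟨ne23, ne24⟩, ne34⟩

/-- **`Ψ₃ = 3 ∏ᵢ (X - xᵢ)` and its roots are exactly the four `xᵢ`.**  Over a field with
`2, 3 ≠ 0`, given the radical data (`ζ² + ζ + 1 = 0`, `δ ≠ 0`, `Rᵢ² = c₄ - 12ζ^iδ`, `R₀R₁R₂ = c₆`)
the multiset of roots of `Ψ₃` is `{x₁, x₂, x₃, x₄}`: the `xᵢ` are four distinct roots of a
polynomial of degree `4` (Mathlib `natDegree_Ψ₃`, `card_roots'`).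
[cite: SilvermanAEC2009, Exercise 3.7] -/
theorem roots_Ψ₃_eq_of_radical (h2 : (2 : F) ≠ 0) (h3 : (3 : F) ≠ 0) {ζ δ R₀ R₁ R₂ : F}
    (hζ : ζ ^ 2 + ζ + 1 = 0) (hδ : δ ≠ 0)
    (h₀ : R₀ ^ 2 = W.c₄ - 12 * δ) (h₁ : R₁ ^ 2 = W.c₄ - 12 * ζ * δ)
    (h₂ : R₂ ^ 2 = W.c₄ - 12 * ζ ^ 2 * δ) (hρ : R₀ * R₁ * R₂ = W.c₆) {x₁ x₂ x₃ x₄ : F}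
    (hx₁ : 12 * x₁ = -W.b₂ + R₀ + R₁ + R₂) (hx₂ : 12 * x₂ = -W.b₂ + R₀ - R₁ - R₂)
    (hx₃ : 12 * x₃ = -W.b₂ - R₀ + R₁ - R₂) (hx₄ : 12 * x₄ = -W.b₂ - R₀ - R₁ + R₂) :
    W.Ψ₃.roots = {x₁, x₂, x₃, x₄} := by
  have h12 : (12 : F) ≠ 0 := by
    rw [show (12 : F) = 2 * 2 * 3 by norm_num]; exact mul_ne_zero (mul_ne_zero h2 h2) h3
  have one_sq : (1 : F) ^ 2 = 1 := one_pow 2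
  have neg_one_sq : (-1 : F) ^ 2 = 1 := by norm_num
  have r₁ : W.Ψ₃.eval x₁ = 0 := W.eval_Ψ₃_eq_zero_of_radical h12 hζ h₀ h₁ h₂ hρ one_sq one_sq one_sq
    (by norm_num) (by linear_combination hx₁)
  have r₂ : W.Ψ₃.eval x₂ = 0 := W.eval_Ψ₃_eq_zero_of_radical h12 hζ h₀ h₁ h₂ hρ one_sq neg_one_sq
    neg_one_sq (by norm_num) (by linear_combination hx₂)
  have r₃ : W.Ψ₃.eval x₃ = 0 := W.eval_Ψ₃_eq_zero_of_radical h12 hζ h₀ h₁ h₂ hρ neg_one_sq one_sq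
    neg_one_sq (by norm_num) (by linear_combination hx₃)
  have r₄ : W.Ψ₃.eval x₄ = 0 := W.eval_Ψ₃_eq_zero_of_radical h12 hζ h₀ h₁ h₂ hρ neg_one_sq neg_one_sq
    one_sq (by norm_num) (by linear_combination hx₄)
  have hnd := W.radical_roots_nodup h2 h3 hζ hδ h₀ h₁ h₂ hx₁ hx₂ hx₃ hx₄
  have hΨ0 : W.Ψ₃ ≠ 0 := W.Ψ₃_ne_zero h3
  have hle : ({x₁, x₂, x₃, x₄} : Multiset F) ≤ W.Ψ₃.roots := by
    rw [Multiset.le_iff_subset hnd]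
    intro a ha
    rw [mem_roots hΨ0, IsRoot.def]
    simp only [Multiset.insert_eq_cons, Multiset.mem_cons, Multiset.mem_singleton] at ha
    rcases ha with rfl | rfl | rfl | rfl
    exacts [r₁, r₂, r₃, r₄]
  have hcard : Multiset.card W.Ψ₃.roots ≤ 4 := by
    calc Multiset.card W.Ψ₃.roots ≤ W.Ψ₃.natDegree := card_roots' _
      _ = 4 := W.natDegree_Ψ₃ h3
  have hcard4 : Multiset.card ({x₁, x₂, x₃, x₄} : Multiset F) = 4 := by simp
  exact (Multiset.eq_of_le_of_card_le hle (by rw [hcard4]; exact hcard)).symm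

/-- **The roots of `Ψ₃` are the `x_ε`.**  Over a field with `2, 3 ≠ 0`, given the radical data
with `δ ≠ 0`: `Ψ₃(x) = 0` iff `12x = -b₂ + ε₀R₀ + ε₁R₁ + ε₂R₂` for some signs `εᵢ ∈ {±1}` with
`ε₀ε₁ε₂ = 1`. [cite: SilvermanAEC2009, Exercise 3.7] -/
theorem eval_Ψ₃_eq_zero_iff_radical (h2 : (2 : F) ≠ 0) (h3 : (3 : F) ≠ 0) {ζ δ R₀ R₁ R₂ : F}
    (hζ : ζ ^ 2 + ζ + 1 = 0) (hδ : δ ≠ 0)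
    (h₀ : R₀ ^ 2 = W.c₄ - 12 * δ) (h₁ : R₁ ^ 2 = W.c₄ - 12 * ζ * δ)
    (h₂ : R₂ ^ 2 = W.c₄ - 12 * ζ ^ 2 * δ) (hρ : R₀ * R₁ * R₂ = W.c₆) (x : F) :
    W.Ψ₃.eval x = 0 ↔ ∃ ε₀ ε₁ ε₂ : F, (ε₀ = 1 ∨ ε₀ = -1) ∧ (ε₁ = 1 ∨ ε₁ = -1) ∧
      (ε₂ = 1 ∨ ε₂ = -1) ∧ ε₀ * ε₁ * ε₂ = 1 ∧ 12 * x = -W.b₂ + ε₀ * R₀ + ε₁ * R₁ + ε₂ * R₂ := by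
  have h12 : (12 : F) ≠ 0 := by
    rw [show (12 : F) = 2 * 2 * 3 by norm_num]; exact mul_ne_zero (mul_ne_zero h2 h2) h3
  constructor
  · intro hx
    set x₁ : F := (-W.b₂ + R₀ + R₁ + R₂) / 12 with hx₁
    set x₂ : F := (-W.b₂ + R₀ - R₁ - R₂) / 12 with hx₂
    set x₃ : F := (-W.b₂ - R₀ + R₁ - R₂) / 12 with hx₃
    set x₄ : F := (-W.b₂ - R₀ - R₁ + R₂) / 12 with hx₄
    have e₁ : 12 * x₁ = -W.b₂ + R₀ + R₁ + R₂ := by rw [hx₁]; field_simp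
    have e₂ : 12 * x₂ = -W.b₂ + R₀ - R₁ - R₂ := by rw [hx₂]; field_simp
    have e₃ : 12 * x₃ = -W.b₂ - R₀ + R₁ - R₂ := by rw [hx₃]; field_simp
    have e₄ : 12 * x₄ = -W.b₂ - R₀ - R₁ + R₂ := by rw [hx₄]; field_simp
    have hroots := W.roots_Ψ₃_eq_of_radical h2 h3 hζ hδ h₀ h₁ h₂ hρ e₁ e₂ e₃ e₄
    have hmem : x ∈ W.Ψ₃.roots := (mem_roots (W.Ψ₃_ne_zero h3)).mpr hx
    rw [hroots] at hmem
    simp only [Multiset.insert_eq_cons, Multiset.mem_cons, Multiset.mem_singleton] at hmem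
    rcases hmem with rfl | rfl | rfl | rfl
    · exact ⟨1, 1, 1, Or.inl rfl, Or.inl rfl, Or.inl rfl, by norm_num, by linear_combination e₁⟩
    · exact ⟨1, -1, -1, Or.inl rfl, Or.inr rfl, Or.inr rfl, by norm_num, by linear_combination e₂⟩
    · exact ⟨-1, 1, -1, Or.inr rfl, Or.inl rfl, Or.inr rfl, by norm_num, by linear_combination e₃⟩
    · exact ⟨-1, -1, 1, Or.inr rfl, Or.inr rfl, Or.inl rfl, by norm_num, by linear_combination e₄⟩
  · rintro ⟨ε₀, ε₁, ε₂, hε₀, hε₁, hε₂, hε, hx⟩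
    have sq : ∀ ε : F, (ε = 1 ∨ ε = -1) → ε ^ 2 = 1 := by
      rintro ε (rfl | rfl) <;> norm_num
    exact W.eval_Ψ₃_eq_zero_of_radical h12 hζ h₀ h₁ h₂ hρ (sq _ hε₀) (sq _ hε₁) (sq _ hε₂) hε hx

/-- **A root of `Ψ₃` is not a root of `Ψ₂²`** (elliptic curve: `Δ ≠ 0`). [cite: SilvermanAEC2009, Exercise 3.7] -/
theorem eval_Ψ₂Sq_ne_zero_of_eval_Ψ₃_eq_zero (hΔ : W.Δ ≠ 0) {x : F} (hx : W.Ψ₃.eval x = 0) :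
    W.Ψ₂Sq.eval x ≠ 0 := fun h ↦
  hΔ (pow_eq_zero_iff two_ne_zero |>.mp (W.Δ_sq_eq_zero_of_eval_Ψ₂Sq_eq_zero_of_eval_Ψ₃_eq_zero h hx))

/-! ### §3. Existence of the radical data over an algebraically closed field -/

/-- **Radical data exist over an algebraically closed field** with `2, 3 ≠ 0`: a primitive cube
root of unity `ζ`, a cube root `δ` of `Δ`, and square roots `R₀, R₁, R₂` of `c₄ - 12ζ^iδ` with
`R₀R₁R₂ = c₆` (the sign of `R₂` is forced by `∏ (c₄ - 12ζ^iδ) = c₆²`; if `R₀R₁ = 0` then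
`c₆ = 0` and any square root `R₂` will do). [folklore] -/
theorem exists_radical [IsAlgClosed F] :
    ∃ ζ δ R₀ R₁ R₂ : F, ζ ^ 2 + ζ + 1 = 0 ∧ δ ^ 3 = W.Δ ∧ R₀ ^ 2 = W.c₄ - 12 * δ ∧
      R₁ ^ 2 = W.c₄ - 12 * ζ * δ ∧ R₂ ^ 2 = W.c₄ - 12 * ζ ^ 2 * δ ∧ R₀ * R₁ * R₂ = W.c₆ := by
  -- `ζ`: a root of `X² + X + 1`
  obtain ⟨ζ, hζ⟩ : ∃ ζ : F, ζ ^ 2 + ζ + 1 = 0 := by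
    have hdeg : (C 1 * X ^ 2 + C 1 * X + C 1 : F[X]).degree ≠ 0 := by
      rw [degree_quadratic one_ne_zero]; exact two_ne_zero
    obtain ⟨ζ, hζ⟩ := IsAlgClosed.exists_root _ hdeg
    refine ⟨ζ, ?_⟩
    rw [IsRoot.def] at hζ
    simpa only [eval_add, eval_mul, eval_C, eval_pow, eval_X, one_mul] using hζ
  obtain ⟨δ, hδ⟩ := IsAlgClosed.exists_pow_nat_eq W.Δ (by norm_num : 0 < 3)
  obtain ⟨R₀, h₀⟩ := IsAlgClosed.exists_pow_nat_eq (W.c₄ - 12 * δ) (by norm_num : 0 < 2)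
  obtain ⟨R₁, h₁⟩ := IsAlgClosed.exists_pow_nat_eq (W.c₄ - 12 * ζ * δ) (by norm_num : 0 < 2)
  have hprod := W.prod_c₄_sub_twelve_mul_eq_c₆_sq hζ hδ
  by_cases h01 : R₀ * R₁ = 0
  · obtain ⟨R₂, h₂⟩ := IsAlgClosed.exists_pow_nat_eq (W.c₄ - 12 * ζ ^ 2 * δ) (by norm_num : 0 < 2)
    have hc₆ : W.c₆ = 0 := by
      have : W.c₆ ^ 2 = 0 := by
        rw [← hprod, ← h₀, ← h₁, show R₀ ^ 2 * R₁ ^ 2 = (R₀ * R₁) ^ 2 by ring, h01]; ring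
      exact pow_eq_zero_iff two_ne_zero |>.mp this
    exact ⟨ζ, δ, R₀, R₁, R₂, hζ, hδ, h₀, h₁, h₂, by rw [h01, zero_mul, hc₆]⟩
  · refine ⟨ζ, δ, R₀, R₁, W.c₆ / (R₀ * R₁), hζ, hδ, h₀, h₁, ?_, ?_⟩
    · have hsq : (R₀ * R₁) ^ 2 ≠ 0 := pow_ne_zero 2 h01
      rw [div_pow, ← hprod, ← h₀, ← h₁,
        show R₀ ^ 2 * R₁ ^ 2 * (W.c₄ - 12 * ζ ^ 2 * δ) = (R₀ * R₁) ^ 2 * (W.c₄ - 12 * ζ ^ 2 * δ)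
          by ring, mul_div_cancel_left₀ _ hsq]
    · rw [← mul_div_assoc, mul_div_cancel_left₀ _ h01]

end Field

end WeierstrassCurve

namespace WeierstrassCurve

/-! ### §4. The `3`-torsion points of `E(K̄)` -/

section Torsion

open Field Literature.NumberTheory.EllipticCurves

variable {K : Type u} [Field K] (W : WeierstrassCurve K)

/-- Base change of the invariants to `K̄`. [folklore] -/
theorem baseChange_algebraicClosure_invariants :
    (W.baseChange (AlgebraicClosure K)).b₂ = algebraMap K (AlgebraicClosure K) W.b₂ ∧
    (W.baseChange (AlgebraicClosure K)).c₄ = algebraMap K (AlgebraicClosure K) W.c₄ ∧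
    (W.baseChange (AlgebraicClosure K)).c₆ = algebraMap K (AlgebraicClosure K) W.c₆ ∧
    (W.baseChange (AlgebraicClosure K)).Δ = algebraMap K (AlgebraicClosure K) W.Δ := by
  refine ⟨?_, ?_, ?_, ?_⟩ <;> simp [baseChange, map_b₂, map_c₄, map_c₆, map_Δ]

/-- `Ψ₂²(x) = (2y + a₁x + a₃)²` on the curve: `4x³ + b₂x² + 2b₄x + b₆ = (y - (-y - a₁x - a₃))²`
for `(x, y)` satisfying the Weierstrass equation. [cite: SilvermanAEC2009, III.2.3 and Exercise 3.7(a)] -/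
theorem eval_Ψ₂Sq_eq_sq_of_equation {F : Type*} [Field F] (V : WeierstrassCurve F) {x y : F}
    (h : V.toAffine.Equation x y) :
    V.Ψ₂Sq.eval x = (y - V.toAffine.negY x y) ^ 2 := by
  rw [Affine.equation_iff] at h
  simp only [Ψ₂Sq, eval_add, eval_mul, eval_pow, eval_C, eval_X, Affine.negY,
    WeierstrassCurve.b₂, WeierstrassCurve.b₄, WeierstrassCurve.b₆]
  linear_combination (-4) * h

/-- **Each `x_ε` is the `x`-coordinate of a point of order `3`.**  For an elliptic curve `E/K`
(`2, 3 ≠ 0` in `K`) and radical data `ζ, δ, R₀, R₁, R₂ ∈ K̄`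
(`ζ² + ζ + 1 = 0`, `Rᵢ² = c₄ - 12ζ^iδ`, `R₀R₁R₂ = c₆`), every `x ∈ K̄` with
`12x = -b₂ + ε₀R₀ + ε₁R₁ + ε₂R₂` (`εᵢ = ±1`, `ε₀ε₁ε₂ = 1`) is `x(T)` for some `T ∈ E[3] ∖ O`:
take `y ∈ K̄` on the curve above `x` (`K̄` algebraically closed); `(x, y)` is not of order `2`
since `Ψ₂²(x) ≠ 0` (`Ψ₃(x) = 0`, `Δ ≠ 0`), and `3(x, y) = O` by `Ψ₃(x) = 0`
(`three_smul_some_eq_zero_iff`, *AEC* Exercise 3.7). [cite: SilvermanAEC2009, Exercise 3.7(d),(f)] -/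
theorem exists_geomTorsion_three_eq_some_of_radical [W.IsElliptic] (h2 : (2 : K) ≠ 0)
    (h3 : (3 : K) ≠ 0) {ζ δ R₀ R₁ R₂ : AlgebraicClosure K} (hζ : ζ ^ 2 + ζ + 1 = 0)
    (h₀ : R₀ ^ 2 = algebraMap K (AlgebraicClosure K) W.c₄ - 12 * δ)
    (h₁ : R₁ ^ 2 = algebraMap K (AlgebraicClosure K) W.c₄ - 12 * ζ * δ)
    (h₂ : R₂ ^ 2 = algebraMap K (AlgebraicClosure K) W.c₄ - 12 * ζ ^ 2 * δ)
    (hρ : R₀ * R₁ * R₂ = algebraMap K (AlgebraicClosure K) W.c₆)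
    {ε₀ ε₁ ε₂ : AlgebraicClosure K} (hε₀ : ε₀ = 1 ∨ ε₀ = -1) (hε₁ : ε₁ = 1 ∨ ε₁ = -1)
    (hε₂ : ε₂ = 1 ∨ ε₂ = -1) (hε : ε₀ * ε₁ * ε₂ = 1) {x : AlgebraicClosure K}
    (hx : 12 * x = -algebraMap K (AlgebraicClosure K) W.b₂ + ε₀ * R₀ + ε₁ * R₁ + ε₂ * R₂) :
    ∃ (T : geomTorsion W (3 : ℕ)) (y : AlgebraicClosure K)
      (h : (W.baseChange (AlgebraicClosure K)).toAffine.Nonsingular x y),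
      (T : geomPoints W) = Affine.Point.some x y h := by
  set W' := W.baseChange (AlgebraicClosure K) with hW'
  obtain ⟨eb₂, ec₄, ec₆, eΔ⟩ := W.baseChange_algebraicClosure_invariants
  have h2' : (2 : AlgebraicClosure K) ≠ 0 := by
    rw [show (2 : AlgebraicClosure K) = algebraMap K _ 2 from (map_ofNat _ 2).symm]
    exact (_root_.map_ne_zero _).mpr h2
  have h3' : (3 : AlgebraicClosure K) ≠ 0 := by
    rw [show (3 : AlgebraicClosure K) = algebraMap K _ 3 from (map_ofNat _ 3).symm]
    exact (_root_.map_ne_zero _).mpr h3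
  have h12 : (12 : AlgebraicClosure K) ≠ 0 := by
    rw [show (12 : AlgebraicClosure K) = 2 * 2 * 3 by norm_num]
    exact mul_ne_zero (mul_ne_zero h2' h2') h3'
  rw [← ec₄] at h₀ h₁ h₂
  rw [← ec₆] at hρ
  rw [← eb₂] at hx
  have sq : ∀ ε : AlgebraicClosure K, (ε = 1 ∨ ε = -1) → ε ^ 2 = 1 := by
    rintro ε (rfl | rfl) <;> norm_num
  have hroot : W'.Ψ₃.eval x = 0 :=
    W'.eval_Ψ₃_eq_zero_of_radical h12 hζ h₀ h₁ h₂ hρ (sq _ hε₀) (sq _ hε₁) (sq _ hε₂) hε hx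
  -- a point above `x`
  obtain ⟨y, hy⟩ : ∃ y : AlgebraicClosure K, W'.toAffine.Equation x y := by
    set p : (AlgebraicClosure K)[X] := C 1 * X ^ 2 + C (W'.a₁ * x + W'.a₃) * X +
      C (-(x ^ 3 + W'.a₂ * x ^ 2 + W'.a₄ * x + W'.a₆)) with hp
    have hdeg : p.degree ≠ 0 := by
      rw [hp, degree_quadratic one_ne_zero]; exact two_ne_zero
    obtain ⟨y, hy⟩ := IsAlgClosed.exists_root p hdeg
    refine ⟨y, ?_⟩
    rw [Affine.equation_iff]
    rw [hp, IsRoot.def] at hy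
    simp only [eval_add, eval_mul, eval_C, eval_pow, eval_X, one_mul] at hy
    linear_combination hy
  have hns : W'.toAffine.Nonsingular x y := (Affine.equation_iff_nonsingular).mp hy
  -- not of order `2`
  have hy2 : y ≠ W'.toAffine.negY x y := by
    intro hyn
    have h0 : W'.Ψ₂Sq.eval x = 0 := by
      rw [W'.eval_Ψ₂Sq_eq_sq_of_equation hy, ← hyn, sub_self, zero_pow two_ne_zero]
    have hΔ' : W'.Δ ≠ 0 := W'.coe_Δ' ▸ W'.Δ'.ne_zero
    exact W'.eval_Ψ₂Sq_ne_zero_of_eval_Ψ₃_eq_zero hΔ' hroot h0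
  -- of order `3`
  have h3T : (3 : ℤ) • (Affine.Point.some x y hns : W'.toAffine.Point) = 0 := by
    rw [W'.three_smul_some_eq_zero_iff hns hy2, ψ_three, evalEval_C]
    exact hroot
  have h3N : (3 : ℕ) • (Affine.Point.some x y hns : W'.toAffine.Point) = 0 := by
    rw [← natCast_zsmul]; exact h3T
  set P : geomPoints W := (Affine.Point.some x y hns : W'.toAffine.Point) with hP
  have hPmem : P ∈ geomTorsion W (3 : ℕ) := AddSubgroup.torsionBy.nsmul_iff.mpr h3N
  exact ⟨⟨P, hPmem⟩, y, hns, rfl⟩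

/-- **The `x`-coordinate of a non-zero `3`-torsion point is an `x_ε`.**  For an elliptic curve
`E/K` (`2, 3 ≠ 0` in `K`) with radical data in `K̄` (`δ³ = Δ`), if `T = (x, y) ∈ E[3]` then
`12x = -b₂ + ε₀R₀ + ε₁R₁ + ε₂R₂` for some signs with `ε₀ε₁ε₂ = 1`: `T` is not of order `2`
(`E[2] ∩ E[3] = O`), so `Ψ₃(x) = 0` (*AEC* Exercise 3.7), and the roots of `Ψ₃` are the `x_ε`
(`eval_Ψ₃_eq_zero_iff_radical`). [cite: SilvermanAEC2009, Exercise 3.7(d),(f)] -/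
theorem radical_of_geomTorsion_three_eq_some [W.IsElliptic] (h2 : (2 : K) ≠ 0)
    (h3 : (3 : K) ≠ 0) {ζ δ R₀ R₁ R₂ : AlgebraicClosure K} (hζ : ζ ^ 2 + ζ + 1 = 0)
    (hδ : δ ^ 3 = algebraMap K (AlgebraicClosure K) W.Δ)
    (h₀ : R₀ ^ 2 = algebraMap K (AlgebraicClosure K) W.c₄ - 12 * δ)
    (h₁ : R₁ ^ 2 = algebraMap K (AlgebraicClosure K) W.c₄ - 12 * ζ * δ)
    (h₂ : R₂ ^ 2 = algebraMap K (AlgebraicClosure K) W.c₄ - 12 * ζ ^ 2 * δ)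
    (hρ : R₀ * R₁ * R₂ = algebraMap K (AlgebraicClosure K) W.c₆)
    {T : geomTorsion W (3 : ℕ)} {x y : AlgebraicClosure K}
    {h : (W.baseChange (AlgebraicClosure K)).toAffine.Nonsingular x y}
    (hT : (T : geomPoints W) = Affine.Point.some x y h) :
    ∃ ε₀ ε₁ ε₂ : AlgebraicClosure K, (ε₀ = 1 ∨ ε₀ = -1) ∧ (ε₁ = 1 ∨ ε₁ = -1) ∧
      (ε₂ = 1 ∨ ε₂ = -1) ∧ ε₀ * ε₁ * ε₂ = 1 ∧
      12 * x = -algebraMap K (AlgebraicClosure K) W.b₂ + ε₀ * R₀ + ε₁ * R₁ + ε₂ * R₂ := by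
  obtain ⟨eb₂, ec₄, ec₆, eΔ⟩ := W.baseChange_algebraicClosure_invariants
  have h2' : (2 : AlgebraicClosure K) ≠ 0 := by
    rw [show (2 : AlgebraicClosure K) = algebraMap K _ 2 from (map_ofNat _ 2).symm]
    exact (_root_.map_ne_zero _).mpr h2
  have h3' : (3 : AlgebraicClosure K) ≠ 0 := by
    rw [show (3 : AlgebraicClosure K) = algebraMap K _ 3 from (map_ofNat _ 3).symm]
    exact (_root_.map_ne_zero _).mpr h3
  rw [← ec₄] at h₀ h₁ h₂
  rw [← ec₆] at hρ
  rw [← eΔ] at hδ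
  rw [← eb₂]
  have hΔ' : (W.baseChange (AlgebraicClosure K)).Δ ≠ 0 :=
    (W.baseChange (AlgebraicClosure K)).coe_Δ' ▸ (W.baseChange (AlgebraicClosure K)).Δ'.ne_zero
  have hδ0 : δ ≠ 0 := by
    intro h0
    rw [h0, zero_pow three_ne_zero] at hδ
    exact hΔ' hδ.symm
  -- `3T = 0`, `T` not of order `2`
  have h3N : (3 : ℕ) • (T : geomPoints W) = 0 := AddSubgroup.torsionBy.nsmul_iff.mp T.2
  rw [hT] at h3N
  have h3T : (3 : ℤ) •
      (Affine.Point.some x y h : (W.baseChange (AlgebraicClosure K)).toAffine.Point) = 0 :=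
    (natCast_zsmul _ 3).trans h3N
  have hy2 : y ≠ (W.baseChange (AlgebraicClosure K)).toAffine.negY x y := by
    intro hyn
    have hneg : -(Affine.Point.some x y h : (W.baseChange (AlgebraicClosure K)).toAffine.Point) =
        Affine.Point.some x y h := by
      rw [Affine.Point.neg_some]
      simp only [Affine.Point.some.injEq, true_and]
      exact hyn.symm
    have h2T : (2 : ℤ) •
        (Affine.Point.some x y h : (W.baseChange (AlgebraicClosure K)).toAffine.Point) = 0 := by
      rw [two_zsmul]
      nth_rewrite 2 [← hneg]
      exact add_neg_cancel _
    have h1T : (Affine.Point.some x y h : (W.baseChange (AlgebraicClosure K)).toAffine.Point) = 0 := by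
      have e : (Affine.Point.some x y h : (W.baseChange (AlgebraicClosure K)).toAffine.Point) =
          (3 : ℤ) • Affine.Point.some x y h - (2 : ℤ) • Affine.Point.some x y h := by
        rw [← sub_smul]; norm_num
      rw [e, h3T, h2T, sub_zero]
    exact Affine.Point.some_ne_zero h h1T
  have hroot : (W.baseChange (AlgebraicClosure K)).Ψ₃.eval x = 0 := by
    have := ((W.baseChange (AlgebraicClosure K)).three_smul_some_eq_zero_iff h hy2).mp h3T
    rwa [ψ_three, evalEval_C] at this
  exact ((W.baseChange (AlgebraicClosure K)).eval_Ψ₃_eq_zero_iff_radical h2' h3' hζ hδ0 h₀ h₁ h₂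
    hρ x).mp hroot

end Torsion

/-! ### §5. The field of `x`-coordinates `K(x(E[3])) = K(R₀, R₁, R₂) = K(ζ₃, ∛Δ, R₀, R₁, R₂)` -/

section XField

open Field Literature.NumberTheory.EllipticCurves Literature.NumberTheory.GaloisRepresentations

variable {K : Type u} [Field K] (W : WeierstrassCurve K)

/-- **`σ ∈ Γ_K` fixes the `x`-coordinates of `E[3]` iff it fixes `R₀, R₁, R₂`.**  For an
elliptic curve `E/K` (`2, 3 ≠ 0` in `K`) with radical data `ζ, δ, Rᵢ ∈ K̄` (`δ³ = Δ`):
the `x(T)`, `T ∈ E[3] ∖ O`, are the `x_ε = (-b₂ + ε₀R₀ + ε₁R₁ + ε₂R₂)/12`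
(`radical_of_geomTorsion_three_eq_some`, `exists_geomTorsion_three_eq_some_of_radical`), and
`4R₀ = 12(x₊₊₊ + x₊₋₋ - x₋₊₋ - x₋₋₊)` etc.  So the subgroup `xFixingSubgroup W 3` of
`DivisionField` is the stabiliser of `(R₀, R₁, R₂)`. [cite: SilvermanAEC2009, III.2.3 and Exercise 3.7] -/
theorem mem_xFixingSubgroup_three_iff_radical [W.IsElliptic] (h2 : (2 : K) ≠ 0)
    (h3 : (3 : K) ≠ 0) {ζ δ R₀ R₁ R₂ : AlgebraicClosure K} (hζ : ζ ^ 2 + ζ + 1 = 0)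
    (hδ : δ ^ 3 = algebraMap K (AlgebraicClosure K) W.Δ)
    (h₀ : R₀ ^ 2 = algebraMap K (AlgebraicClosure K) W.c₄ - 12 * δ)
    (h₁ : R₁ ^ 2 = algebraMap K (AlgebraicClosure K) W.c₄ - 12 * ζ * δ)
    (h₂ : R₂ ^ 2 = algebraMap K (AlgebraicClosure K) W.c₄ - 12 * ζ ^ 2 * δ)
    (hρ : R₀ * R₁ * R₂ = algebraMap K (AlgebraicClosure K) W.c₆) (σ : absoluteGaloisGroup K) :
    σ ∈ W.xFixingSubgroup 3 ↔ σ • R₀ = R₀ ∧ σ • R₁ = R₁ ∧ σ • R₂ = R₂ := by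
  have h2' : (2 : AlgebraicClosure K) ≠ 0 := by
    rw [show (2 : AlgebraicClosure K) = algebraMap K _ 2 from (map_ofNat _ 2).symm]
    exact (_root_.map_ne_zero _).mpr h2
  have h3' : (3 : AlgebraicClosure K) ≠ 0 := by
    rw [show (3 : AlgebraicClosure K) = algebraMap K _ 3 from (map_ofNat _ 3).symm]
    exact (_root_.map_ne_zero _).mpr h3
  have h4' : (4 : AlgebraicClosure K) ≠ 0 := by
    rw [show (4 : AlgebraicClosure K) = 2 * 2 by norm_num]; exact mul_ne_zero h2' h2'
  have h12 : (12 : AlgebraicClosure K) ≠ 0 := by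
    rw [show (12 : AlgebraicClosure K) = 2 * 2 * 3 by norm_num]
    exact mul_ne_zero (mul_ne_zero h2' h2') h3'
  have hb₂ : σ • algebraMap K (AlgebraicClosure K) W.b₂ = algebraMap K (AlgebraicClosure K) W.b₂ :=
    smul_algebraMap σ W.b₂
  have hnum : ∀ n : ℕ, σ • ((n : AlgebraicClosure K)) = n := fun n ↦ by
    rw [show ((n : AlgebraicClosure K)) = algebraMap K (AlgebraicClosure K) n from
      (map_natCast _ n).symm]
    exact smul_algebraMap σ (n : K)
  have h12σ : σ • (12 : AlgebraicClosure K) = 12 := by exact_mod_cast hnum 12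
  have h4σ : σ • (4 : AlgebraicClosure K) = 4 := by exact_mod_cast hnum 4
  constructor
  · intro hσ
    -- the four roots and their points
    set x₁ : AlgebraicClosure K := (-algebraMap K (AlgebraicClosure K) W.b₂ + R₀ + R₁ + R₂) / 12
    set x₂ : AlgebraicClosure K := (-algebraMap K (AlgebraicClosure K) W.b₂ + R₀ - R₁ - R₂) / 12
    set x₃ : AlgebraicClosure K := (-algebraMap K (AlgebraicClosure K) W.b₂ - R₀ + R₁ - R₂) / 12
    set x₄ : AlgebraicClosure K := (-algebraMap K (AlgebraicClosure K) W.b₂ - R₀ - R₁ + R₂) / 12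
    have hdiv : ∀ t : AlgebraicClosure K, 12 * (t / 12) = t := fun t ↦ by field_simp
    have e₁ : 12 * x₁ = -algebraMap K (AlgebraicClosure K) W.b₂ + 1 * R₀ + 1 * R₁ + 1 * R₂ := by
      simp only [x₁]; rw [hdiv]; ring
    have e₂ : 12 * x₂ = -algebraMap K (AlgebraicClosure K) W.b₂ + 1 * R₀ + (-1) * R₁ + (-1) * R₂ := by
      simp only [x₂]; rw [hdiv]; ring
    have e₃ : 12 * x₃ = -algebraMap K (AlgebraicClosure K) W.b₂ + (-1) * R₀ + 1 * R₁ + (-1) * R₂ := by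
      simp only [x₃]; rw [hdiv]; ring
    have e₄ : 12 * x₄ = -algebraMap K (AlgebraicClosure K) W.b₂ + (-1) * R₀ + (-1) * R₁ + 1 * R₂ := by
      simp only [x₄]; rw [hdiv]; ring
    have fix : ∀ {ε₀ ε₁ ε₂ x : AlgebraicClosure K}, (ε₀ = 1 ∨ ε₀ = -1) → (ε₁ = 1 ∨ ε₁ = -1) →
        (ε₂ = 1 ∨ ε₂ = -1) → ε₀ * ε₁ * ε₂ = 1 →
        12 * x = -algebraMap K (AlgebraicClosure K) W.b₂ + ε₀ * R₀ + ε₁ * R₁ + ε₂ * R₂ →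
        σ • x = x := by
      intro ε₀ ε₁ ε₂ x hε₀ hε₁ hε₂ hε hx
      obtain ⟨T, y, h, hT⟩ :=
        W.exists_geomTorsion_three_eq_some_of_radical h2 h3 hζ h₀ h₁ h₂ hρ hε₀ hε₁ hε₂ hε hx
      exact (W.mem_xFixingSubgroup_iff 3).mp hσ T x y h hT
    have f₁ := fix (Or.inl rfl) (Or.inl rfl) (Or.inl rfl) (by norm_num) e₁
    have f₂ := fix (Or.inl rfl) (Or.inr rfl) (Or.inr rfl) (by norm_num) e₂
    have f₃ := fix (Or.inr rfl) (Or.inl rfl) (Or.inr rfl) (by norm_num) e₃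
    have f₄ := fix (Or.inr rfl) (Or.inr rfl) (Or.inl rfl) (by norm_num) e₄
    -- `4R₀ = 12(x₁ + x₂ - x₃ - x₄)` etc.
    have eR₀ : 4 * R₀ = 12 * (x₁ + x₂ - x₃ - x₄) := by
      linear_combination (-1) * (e₁ + e₂ - e₃ - e₄)
    have eR₁ : 4 * R₁ = 12 * (x₁ - x₂ + x₃ - x₄) := by
      linear_combination (-1) * (e₁ - e₂ + e₃ - e₄)
    have eR₂ : 4 * R₂ = 12 * (x₁ - x₂ - x₃ + x₄) := by
      linear_combination (-1) * (e₁ - e₂ - e₃ + e₄)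
    have cancel : ∀ {r : AlgebraicClosure K}, σ • (4 * r) = 4 * r → σ • r = r := by
      intro r hr
      rw [smul_mul', h4σ] at hr
      exact mul_left_cancel₀ h4' hr
    refine ⟨cancel ?_, cancel ?_, cancel ?_⟩
    · rw [eR₀, smul_mul', h12σ, smul_sub, smul_sub, smul_add, f₁, f₂, f₃, f₄]
    · rw [eR₁, smul_mul', h12σ, smul_sub, smul_add, smul_sub, f₁, f₂, f₃, f₄]
    · rw [eR₂, smul_mul', h12σ, smul_add, smul_sub, smul_sub, f₁, f₂, f₃, f₄]
  · rintro ⟨hR₀, hR₁, hR₂⟩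
    refine (W.mem_xFixingSubgroup_iff 3).mpr fun T x y h hT ↦ ?_
    obtain ⟨ε₀, ε₁, ε₂, hε₀, hε₁, hε₂, -, hx⟩ :=
      W.radical_of_geomTorsion_three_eq_some h2 h3 hζ hδ h₀ h₁ h₂ hρ hT
    have hεσ : ∀ ε : AlgebraicClosure K, (ε = 1 ∨ ε = -1) → σ • ε = ε := by
      rintro ε (rfl | rfl)
      · exact smul_one σ
      · rw [smul_neg, smul_one]
    have h12x : σ • (12 * x) = 12 * x := by
      rw [hx, smul_add, smul_add, smul_add, smul_neg, hb₂, smul_mul', smul_mul', smul_mul',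
        hεσ _ hε₀, hεσ _ hε₁, hεσ _ hε₂, hR₀, hR₁, hR₂]
    rw [smul_mul', h12σ] at h12x
    exact mul_left_cancel₀ h12 h12x

/-- **`R₀, R₁, R₂ ∈ K(x(E[3]))`.** [cite: SilvermanAEC2009, III.2.3 and Exercise 3.7] -/
theorem radical_mem_xDivisionField_three [W.IsElliptic] (h2 : (2 : K) ≠ 0)
    (h3 : (3 : K) ≠ 0) {ζ δ R₀ R₁ R₂ : AlgebraicClosure K} (hζ : ζ ^ 2 + ζ + 1 = 0)
    (hδ : δ ^ 3 = algebraMap K (AlgebraicClosure K) W.Δ)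
    (h₀ : R₀ ^ 2 = algebraMap K (AlgebraicClosure K) W.c₄ - 12 * δ)
    (h₁ : R₁ ^ 2 = algebraMap K (AlgebraicClosure K) W.c₄ - 12 * ζ * δ)
    (h₂ : R₂ ^ 2 = algebraMap K (AlgebraicClosure K) W.c₄ - 12 * ζ ^ 2 * δ)
    (hρ : R₀ * R₁ * R₂ = algebraMap K (AlgebraicClosure K) W.c₆) :
    R₀ ∈ W.xDivisionField 3 ∧ R₁ ∈ W.xDivisionField 3 ∧ R₂ ∈ W.xDivisionField 3 := by
  rw [xDivisionField_def]
  refine ⟨?_, ?_, ?_⟩ <;> rw [IntermediateField.mem_fixedField_iff] <;> intro σ hσ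
  · exact ((W.mem_xFixingSubgroup_three_iff_radical h2 h3 hζ hδ h₀ h₁ h₂ hρ σ).mp hσ).1
  · exact ((W.mem_xFixingSubgroup_three_iff_radical h2 h3 hζ hδ h₀ h₁ h₂ hρ σ).mp hσ).2.1
  · exact ((W.mem_xFixingSubgroup_three_iff_radical h2 h3 hζ hδ h₀ h₁ h₂ hρ σ).mp hσ).2.2

/-- **`ζ₃, ∛Δ ∈ K(x(E[3]))`**: `(1 + ζ)(R₁² - R₀²) = R₂² - R₀²` and `12δ(1 - ζ) = R₁² - R₀²` with
`R₁² ≠ R₀²`, `ζ ≠ 1`.  (The fixed field of `PSL₂(𝔽₃) ≅ A₄ ⊆ S₄` is `K(ζ₃)`, that of the four-group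
is `K(ζ₃, ∛Δ)`.) [cite: SerreAbelianLadic1968, IV.1.1–1.2] -/
theorem zeta_mem_and_delta_mem_xDivisionField_three [W.IsElliptic] (h2 : (2 : K) ≠ 0)
    (h3 : (3 : K) ≠ 0) {ζ δ R₀ R₁ R₂ : AlgebraicClosure K} (hζ : ζ ^ 2 + ζ + 1 = 0)
    (hδ : δ ^ 3 = algebraMap K (AlgebraicClosure K) W.Δ)
    (h₀ : R₀ ^ 2 = algebraMap K (AlgebraicClosure K) W.c₄ - 12 * δ)
    (h₁ : R₁ ^ 2 = algebraMap K (AlgebraicClosure K) W.c₄ - 12 * ζ * δ)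
    (h₂ : R₂ ^ 2 = algebraMap K (AlgebraicClosure K) W.c₄ - 12 * ζ ^ 2 * δ)
    (hρ : R₀ * R₁ * R₂ = algebraMap K (AlgebraicClosure K) W.c₆) :
    ζ ∈ W.xDivisionField 3 ∧ δ ∈ W.xDivisionField 3 := by
  obtain ⟨m₀, m₁, m₂⟩ := W.radical_mem_xDivisionField_three h2 h3 hζ hδ h₀ h₁ h₂ hρ
  obtain ⟨-, ec₄, -, eΔ⟩ := W.baseChange_algebraicClosure_invariants
  have h2' : (2 : AlgebraicClosure K) ≠ 0 := by
    rw [show (2 : AlgebraicClosure K) = algebraMap K _ 2 from (map_ofNat _ 2).symm]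
    exact (_root_.map_ne_zero _).mpr h2
  have h3' : (3 : AlgebraicClosure K) ≠ 0 := by
    rw [show (3 : AlgebraicClosure K) = algebraMap K _ 3 from (map_ofNat _ 3).symm]
    exact (_root_.map_ne_zero _).mpr h3
  have h12 : (12 : AlgebraicClosure K) ≠ 0 := by
    rw [show (12 : AlgebraicClosure K) = 2 * 2 * 3 by norm_num]
    exact mul_ne_zero (mul_ne_zero h2' h2') h3'
  have hδ0 : δ ≠ 0 := by
    intro h0
    rw [h0, zero_pow three_ne_zero, ← eΔ] at hδ
    exact ((W.baseChange (AlgebraicClosure K)).coe_Δ' ▸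
      (W.baseChange (AlgebraicClosure K)).Δ'.ne_zero :
        (W.baseChange (AlgebraicClosure K)).Δ ≠ 0) hδ.symm
  rw [← ec₄] at h₀ h₁ h₂
  obtain ⟨h01, -, -⟩ := (W.baseChange (AlgebraicClosure K)).radical_sq_ne h2' h3' hζ hδ0 h₀ h₁ h₂
  obtain ⟨hz1, -, -⟩ := ne_of_sq_add_self_add_one h3' hζ
  have hd : R₁ ^ 2 - R₀ ^ 2 ≠ 0 := sub_ne_zero.mpr (Ne.symm h01)
  set E := W.xDivisionField 3
  have hζE : ζ ∈ E := by
    have e : ζ = (R₂ ^ 2 - R₀ ^ 2) / (R₁ ^ 2 - R₀ ^ 2) - 1 := by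
      rw [eq_sub_iff_add_eq, eq_div_iff hd]
      linear_combination (ζ + 1) * (h₁ - h₀) - (h₂ - h₀)
    rw [e]
    exact sub_mem (div_mem (sub_mem (pow_mem m₂ 2) (pow_mem m₀ 2))
      (sub_mem (pow_mem m₁ 2) (pow_mem m₀ 2))) (one_mem E)
  refine ⟨hζE, ?_⟩
  have e : δ = (R₁ ^ 2 - R₀ ^ 2) / (12 * (1 - ζ)) := by
    have h1z : (1 - ζ) ≠ 0 := sub_ne_zero.mpr (Ne.symm hz1)
    rw [eq_div_iff (mul_ne_zero h12 h1z)]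
    linear_combination h₀ - h₁
  rw [e]
  refine div_mem (sub_mem (pow_mem m₁ 2) (pow_mem m₀ 2)) (mul_mem ?_ (sub_mem (one_mem E) hζE))
  exact_mod_cast (natCast_mem E 12)

variable [CharZero K]

/-- **`σ|_{K(x(E[3]))} = 1 ↔ σ` fixes `R₀, R₁, R₂`** (`char K = 0`, `E` elliptic):
`DivisionField.absRestrictNormalHom_xDivisionField_eq_one_iff` with
`mem_xFixingSubgroup_three_iff_radical`.  With `absRestrictNormalHom_eq_one_iff_of_forall_x`
(`ThreeTorsionCentralInvolutionSwanProofs`) this identifies the kernel of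
`Gal(K(E[3])/K) → Gal(K(x(E[3]))/K)` on explicit generators. [cite: SilvermanAEC2009, III.2.3 and Exercise 3.7] -/
theorem absRestrictNormalHom_xDivisionField_three_eq_one_iff_radical [W.IsElliptic]
    {ζ δ R₀ R₁ R₂ : AlgebraicClosure K} (hζ : ζ ^ 2 + ζ + 1 = 0)
    (hδ : δ ^ 3 = algebraMap K (AlgebraicClosure K) W.Δ)
    (h₀ : R₀ ^ 2 = algebraMap K (AlgebraicClosure K) W.c₄ - 12 * δ)
    (h₁ : R₁ ^ 2 = algebraMap K (AlgebraicClosure K) W.c₄ - 12 * ζ * δ)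
    (h₂ : R₂ ^ 2 = algebraMap K (AlgebraicClosure K) W.c₄ - 12 * ζ ^ 2 * δ)
    (hρ : R₀ * R₁ * R₂ = algebraMap K (AlgebraicClosure K) W.c₆) (σ : absoluteGaloisGroup K) :
    absRestrictNormalHom (W.xDivisionField 3) σ = 1 ↔ σ • R₀ = R₀ ∧ σ • R₁ = R₁ ∧ σ • R₂ = R₂ := by
  rw [W.absRestrictNormalHom_xDivisionField_eq_one_iff 3 σ, ← W.mem_xFixingSubgroup_iff 3]
  exact W.mem_xFixingSubgroup_three_iff_radical two_ne_zero three_ne_zero hζ hδ h₀ h₁ h₂ hρ σ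

/-- **`K(x(E[3])) = K(R₀, R₁, R₂)`** (`char K = 0`, `E` elliptic): the fixed field of
`xFixingSubgroup W 3 = Stab(R₀, R₁, R₂) ⊇ Γ_{K(R₀,R₁,R₂)}` is contained in `K(R₀, R₁, R₂)`
(Galois correspondence for `K̄/K`, Mathlib `InfiniteGalois.fixedField_fixingSubgroup`), and
contains the `Rᵢ`. [cite: SilvermanAEC2009, III.2.3 and Exercise 3.7] -/
theorem xDivisionField_three_eq_adjoin_radical [W.IsElliptic]
    {ζ δ R₀ R₁ R₂ : AlgebraicClosure K} (hζ : ζ ^ 2 + ζ + 1 = 0)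
    (hδ : δ ^ 3 = algebraMap K (AlgebraicClosure K) W.Δ)
    (h₀ : R₀ ^ 2 = algebraMap K (AlgebraicClosure K) W.c₄ - 12 * δ)
    (h₁ : R₁ ^ 2 = algebraMap K (AlgebraicClosure K) W.c₄ - 12 * ζ * δ)
    (h₂ : R₂ ^ 2 = algebraMap K (AlgebraicClosure K) W.c₄ - 12 * ζ ^ 2 * δ)
    (hρ : R₀ * R₁ * R₂ = algebraMap K (AlgebraicClosure K) W.c₆) :
    W.xDivisionField 3 = IntermediateField.adjoin K {R₀, R₁, R₂} := by
  haveI : IsGalois K (AlgebraicClosure K) := {}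
  obtain ⟨m₀, m₁, m₂⟩ := W.radical_mem_xDivisionField_three two_ne_zero three_ne_zero hζ hδ h₀ h₁ h₂ hρ
  apply le_antisymm
  · -- `Γ_{K(R₀,R₁,R₂)} ≤ xFixingSubgroup`, so `K(x(E[3])) ≤ K(R₀,R₁,R₂)`
    have hle : (IntermediateField.adjoin K ({R₀, R₁, R₂} : Set (AlgebraicClosure K))).fixingSubgroup ≤
        W.xFixingSubgroup 3 := by
      intro σ hσ
      rw [IntermediateField.mem_fixingSubgroup_iff] at hσ
      refine (W.mem_xFixingSubgroup_three_iff_radical two_ne_zero three_ne_zero hζ hδ h₀ h₁ h₂ hρ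
        σ).mpr ⟨?_, ?_, ?_⟩
      · exact hσ R₀ (IntermediateField.subset_adjoin K _ (by simp))
      · exact hσ R₁ (IntermediateField.subset_adjoin K _ (by simp))
      · exact hσ R₂ (IntermediateField.subset_adjoin K _ (by simp))
    calc W.xDivisionField 3
        = IntermediateField.fixedField (W.xFixingSubgroup 3) := rfl
      _ ≤ IntermediateField.fixedField
          (IntermediateField.adjoin K ({R₀, R₁, R₂} : Set (AlgebraicClosure K))).fixingSubgroup :=
        IntermediateField.fixedField_le hle
      _ = IntermediateField.adjoin K {R₀, R₁, R₂} := InfiniteGalois.fixedField_fixingSubgroup _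
  · rw [IntermediateField.adjoin_le_iff]
    intro r hr
    simp only [Set.mem_insert_iff, Set.mem_singleton_iff] at hr
    rcases hr with rfl | rfl | rfl
    exacts [m₀, m₁, m₂]

end XField

end WeierstrassCurve
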